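import Summits.Ventures.PercRepro.S2UniqueCircuit
import Summits.Ventures.PercRepro.S2BasesTriangles
import Summits.Ventures.PercRepro.S2RankThreeCount
import Summits.Ventures.PercRepro.S2SpreadTriangles

/-!
# PercRepro — S2: THE TOP `5`-SETS HIT EVERY PAIR OF CIRCUITS — THE HITTING LEVER AT CORANK `6` (p7, gen 14; sub-claim S2; the cell `(14, 6)`)

At corank `6` a top `5`-set `B` (`ρ(B) = 5`, `E ∖ B` spanning) has a complement of `p + 1` points and rank `p`: a set of
nullity `1`, which contains exactly ONE circuit (`S2.isCircuit_eq_of_disjoint_of_spanning_compl`, g9). So `B` meets the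
union `C₁ ∪ C₂` of ANY two distinct circuits — the kit's `C(n, 5)` for the `5`-sets drops by `C(n − |C₁ ∪ C₂|, 5)`, and
with three triangles `B` misses at most one of them. A top `6`-set is a COBASIS: `E ∖ B` is a basis, so `B` meets every
circuit, and through a triangle `T` the top `6`-sets `T ∪ X` have `X` a `3`-subset of `E ∖ T` meeting every circuit
avoiding `T`. The counts are one inclusion–exclusion on the complement families
(**`ncard_subsets_inter_nonempty_add_le`**: `#{X ⊆ Z : |X| = k, X ∩ Y₁ ≠ ∅, X ∩ Y₂ ≠ ∅} + C(|Z ∖ Y₁|, k) + C(|Z ∖ Y₂|, k)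
≤ C(|Z|, k) + C(|Z ∖ (Y₁ ∪ Y₂)|, k)`):
* **`ncard_top_five_add_le_of_hit`** — the top `5`-sets against two sets every top `5`-set meets;
* **`top_five_inter_union_nonempty`** — at corank `6` every top `5`-set meets `C₁ ∪ C₂` (`C₁ ≠ C₂` circuits);
* **`ncard_cobases_through_add_le_two`** — the top `6`-sets through `T` with two circuits `D₁`, `D₂` avoiding `T`
  (at `(14, 6)`: `≤ C(17, 3) − 2·C(14, 3) + C(12, 3) = 172` for two triangles sharing a point, `117` disjoint);
* **`ncard_triangles_le_seven_add_disjoint`**, **`exists_two_disjoint_triangles_of_nine`** — on a spread core at most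
  `6` triangles meet a given triangle `T` (`S2.not_four_triangles_through`), so with `≥ 9` triangles two of them avoid `T`.
Axioms: standard.
-/

open scoped Matroid

namespace PercRepro

namespace S2

open Set

variable {α : Type}

/-- **The `k`-subsets of a finite set `Z` meeting both `Y₁` and `Y₂`**, by inclusion–exclusion on the complement families
`𝒫_k(Z ∖ Y₁)`, `𝒫_k(Z ∖ Y₂)` (whose intersection is `𝒫_k(Z ∖ (Y₁ ∪ Y₂))`). -/
theorem ncard_subsets_inter_nonempty_add_le (Z Y₁ Y₂ : Set α) (hZ : Z.Finite) (k : ℕ) :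
    {X : Set α | X ⊆ Z ∧ X.ncard = k ∧ (X ∩ Y₁).Nonempty ∧ (X ∩ Y₂).Nonempty}.ncard +
      (Z \ Y₁).ncard.choose k + (Z \ Y₂).ncard.choose k ≤
      Z.ncard.choose k + (Z \ (Y₁ ∪ Y₂)).ncard.choose k := by
  classical
  set P := {X : Set α | X ⊆ Z ∧ X.ncard = k} with hP
  set A₁ := {X : Set α | X ⊆ Z \ Y₁ ∧ X.ncard = k} with hA₁
  set A₂ := {X : Set α | X ⊆ Z \ Y₂ ∧ X.ncard = k} with hA₂
  have hPfin : P.Finite := hZ.finite_subsets.subset (fun X hX => hX.1)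
  have hA₁P : A₁ ⊆ P := fun X hX => ⟨hX.1.trans sdiff_subset, hX.2⟩
  have hA₂P : A₂ ⊆ P := fun X hX => ⟨hX.1.trans sdiff_subset, hX.2⟩
  have hA₁fin : A₁.Finite := hPfin.subset hA₁P
  have hA₂fin : A₂.Finite := hPfin.subset hA₂P
  have hH : {X : Set α | X ⊆ Z ∧ X.ncard = k ∧ (X ∩ Y₁).Nonempty ∧ (X ∩ Y₂).Nonempty} ⊆ P \ (A₁ ∪ A₂) := by
    rintro X ⟨hXZ, hXk, hX1, hX2⟩
    refine ⟨⟨hXZ, hXk⟩, ?_⟩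
    rintro (h | h)
    · obtain ⟨y, hyX, hyY⟩ := hX1
      exact (h.1 hyX).2 hyY
    · obtain ⟨y, hyX, hyY⟩ := hX2
      exact (h.1 hyX).2 hyY
  have hinter : A₁ ∩ A₂ = {X : Set α | X ⊆ Z \ (Y₁ ∪ Y₂) ∧ X.ncard = k} := by
    ext X
    simp only [hA₁, hA₂, Set.mem_inter_iff, Set.mem_setOf_eq]
    constructor
    · rintro ⟨⟨h1, hk⟩, ⟨h2, -⟩⟩
      refine ⟨fun y hy => ⟨(h1 hy).1, ?_⟩, hk⟩
      rintro (hy1 | hy2)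
      · exact (h1 hy).2 hy1
      · exact (h2 hy).2 hy2
    · rintro ⟨h, hk⟩
      exact ⟨⟨fun y hy => ⟨(h hy).1, fun hy1 => (h hy).2 (Or.inl hy1)⟩, hk⟩,
        ⟨fun y hy => ⟨(h hy).1, fun hy2 => (h hy).2 (Or.inr hy2)⟩, hk⟩⟩
  have h1 := Set.ncard_le_ncard hH hPfin.sdiff
  have h2 := Set.ncard_sdiff_add_ncard_of_subset (Set.union_subset hA₁P hA₂P) hPfin
  have h3 := Set.ncard_union_add_ncard_inter A₁ A₂ hA₁fin hA₂fin
  have hPc : P.ncard = Z.ncard.choose k := ncard_subsets_ncard_eq Z hZ k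
  have hA₁c : A₁.ncard = (Z \ Y₁).ncard.choose k := ncard_subsets_ncard_eq (Z \ Y₁) hZ.sdiff k
  have hA₂c : A₂.ncard = (Z \ Y₂).ncard.choose k := ncard_subsets_ncard_eq (Z \ Y₂) hZ.sdiff k
  have hIc : (A₁ ∩ A₂).ncard = (Z \ (Y₁ ∪ Y₂)).ncard.choose k := by
    rw [hinter]; exact ncard_subsets_ncard_eq (Z \ (Y₁ ∪ Y₂)) hZ.sdiff k
  omega

/-- **The top `5`-sets against two sets `Y₁`, `Y₂` that every top `5`-set meets** (supplied by the hitting lemma):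
`#top5 + C(|E ∖ Y₁|, 5) + C(|E ∖ Y₂|, 5) ≤ C(|E|, 5) + C(|E ∖ (Y₁ ∪ Y₂)|, 5)`. -/
theorem ncard_top_five_add_le_of_hit (M : Matroid α) [M.Finite] (Y₁ Y₂ : Set α)
    (hY₁ : ∀ B ⊆ M.E, B.ncard = 5 → M.eRk (M.E \ B) = M.eRank → (B ∩ Y₁).Nonempty)
    (hY₂ : ∀ B ⊆ M.E, B.ncard = 5 → M.eRk (M.E \ B) = M.eRank → (B ∩ Y₂).Nonempty) :
    {B : Set α | B ⊆ M.E ∧ B.ncard = 5 ∧ M.eRk B = 5 ∧ M.eRk (M.E \ B) = M.eRank}.ncard +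
      (M.E \ Y₁).ncard.choose 5 + (M.E \ Y₂).ncard.choose 5 ≤
      M.E.ncard.choose 5 + (M.E \ (Y₁ ∪ Y₂)).ncard.choose 5 := by
  have h := ncard_subsets_inter_nonempty_add_le M.E Y₁ Y₂ M.ground_finite 5
  have hsub : {B : Set α | B ⊆ M.E ∧ B.ncard = 5 ∧ M.eRk B = 5 ∧ M.eRk (M.E \ B) = M.eRank} ⊆
      {X : Set α | X ⊆ M.E ∧ X.ncard = 5 ∧ (X ∩ Y₁).Nonempty ∧ (X ∩ Y₂).Nonempty} := by
    rintro B ⟨hBE, hB5, -, hBs⟩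
    exact ⟨hBE, hB5, hY₁ B hBE hB5 hBs, hY₂ B hBE hB5 hBs⟩
  have hle := Set.ncard_le_ncard hsub (M.ground_finite.finite_subsets.subset (fun X hX => hX.1))
  omega

/-- **At corank `6` every top `5`-set meets the union of any two distinct circuits**: its complement has `p + 1` points and
rank `p`, a set of nullity `1` with exactly one circuit inside (`S2.isCircuit_eq_of_disjoint_of_spanning_compl`). -/
theorem top_five_inter_union_nonempty (M : Matroid α) [M.Finite] {p : ℕ} (hR : M.eRank = (p : ℕ∞))
    (hn : M.E.ncard = p + 6) {C₁ C₂ : Set α} (h₁ : M.IsCircuit C₁) (h₂ : M.IsCircuit C₂) (hne : C₁ ≠ C₂) :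
    ∀ B ⊆ M.E, B.ncard = 5 → M.eRk (M.E \ B) = M.eRank → (B ∩ (C₁ ∪ C₂)).Nonempty := by
  intro B hBE hB5 hBs
  by_contra hcon
  rw [Set.not_nonempty_iff_eq_empty] at hcon
  have hd : M.E.encard = M.eRank + (((5 : ℕ) : ℕ∞) + 1) := by
    rw [hR, ← M.ground_finite.cast_ncard_eq, hn]
    push_cast
    ring
  have hBk : B.encard = ((5 : ℕ) : ℕ∞) := by
    rw [← (M.ground_finite.subset hBE).cast_ncard_eq, hB5]
  have hdis₁ : Disjoint C₁ B := by
    rw [Set.disjoint_left]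
    intro y hy hyB
    have : y ∈ B ∩ (C₁ ∪ C₂) := ⟨hyB, Or.inl hy⟩
    rw [hcon] at this
    exact this
  have hdis₂ : Disjoint C₂ B := by
    rw [Set.disjoint_left]
    intro y hy hyB
    have : y ∈ B ∩ (C₁ ∪ C₂) := ⟨hyB, Or.inr hy⟩
    rw [hcon] at this
    exact this
  exact hne (isCircuit_eq_of_disjoint_of_spanning_compl M hBE hd hBk hBs h₁ hdis₁ h₂ hdis₂)

/-- **The top `6`-sets through `T` at corank `6`, with two circuits `D₁`, `D₂` avoiding `T`**: `B ↦ B ∖ T` is injective into the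
`3`-subsets of `E ∖ T` meeting both `D₁` and `D₂` (the complement `E ∖ B` is a basis, so no circuit avoids `B`). -/
theorem ncard_cobases_through_add_le_two (M : Matroid α) [M.Finite] {p : ℕ} (hR : M.eRank = (p : ℕ∞))
    (hn : M.E.ncard = p + 6) {T D₁ D₂ : Set α} (hT : T ⊆ M.E) (hT3 : T.ncard = 3)
    (h₁ : M.IsCircuit D₁) (h₂ : M.IsCircuit D₂) (hd₁ : Disjoint D₁ T) (hd₂ : Disjoint D₂ T) :
    {B : Set α | B ⊆ M.E ∧ B.ncard = 6 ∧ T ⊆ B ∧ M.eRk (M.E \ B) = M.eRank}.ncard +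
      ((M.E \ T) \ D₁).ncard.choose 3 + ((M.E \ T) \ D₂).ncard.choose 3 ≤
      (M.E \ T).ncard.choose 3 + ((M.E \ T) \ (D₁ ∪ D₂)).ncard.choose 3 := by
  classical
  have hTfin : T.Finite := M.ground_finite.subset hT
  have hZfin : (M.E \ T).Finite := M.ground_finite.sdiff
  have h := ncard_subsets_inter_nonempty_add_le (M.E \ T) D₁ D₂ hZfin 3
  have hmeet : ∀ B ∈ {B : Set α | B ⊆ M.E ∧ B.ncard = 6 ∧ T ⊆ B ∧ M.eRk (M.E \ B) = M.eRank},
      ∀ {D : Set α}, M.IsCircuit D → Disjoint D T → ((B \ T) ∩ D).Nonempty := by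
    rintro B ⟨hBE, hB6, hTB, hBs⟩ D hD hDT
    have hBfin : B.Finite := M.ground_finite.subset hBE
    have hcard : (M.E \ B).ncard = p := by
      rw [Set.ncard_sdiff hBE hBfin, hn, hB6]
      omega
    have hind : M.Indep (M.E \ B) := by
      rw [Matroid.indep_iff_eRk_eq_encard_of_finite M.ground_finite.sdiff, hBs, hR,
        ← M.ground_finite.sdiff.cast_ncard_eq, hcard]
    by_contra hcon
    rw [Set.not_nonempty_iff_eq_empty] at hcon
    have hDB : D ⊆ M.E \ B := by
      intro y hy
      refine ⟨hD.subset_ground hy, fun hyB => ?_⟩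
      have hyT : y ∉ T := fun hyT => Set.disjoint_left.1 hDT hy hyT
      have : y ∈ (B \ T) ∩ D := ⟨⟨hyB, hyT⟩, hy⟩
      rw [hcon] at this
      exact this
    exact hD.not_indep (hind.subset hDB)
  have hmaps : ∀ B ∈ {B : Set α | B ⊆ M.E ∧ B.ncard = 6 ∧ T ⊆ B ∧ M.eRk (M.E \ B) = M.eRank},
      (fun B : Set α => B \ T) B ∈
        {X : Set α | X ⊆ M.E \ T ∧ X.ncard = 3 ∧ (X ∩ D₁).Nonempty ∧ (X ∩ D₂).Nonempty} := by
    intro B hB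
    refine ⟨sdiff_subset_sdiff_left hB.1, ?_, hmeet B hB h₁ hd₁, hmeet B hB h₂ hd₂⟩
    rw [Set.ncard_sdiff hB.2.2.1 hTfin, hB.2.1, hT3]
  have hinj : Set.InjOn (fun B : Set α => B \ T)
      {B : Set α | B ⊆ M.E ∧ B.ncard = 6 ∧ T ⊆ B ∧ M.eRk (M.E \ B) = M.eRank} := by
    rintro B₁ ⟨-, -, hT₁, -⟩ B₂ ⟨-, -, hT₂, -⟩ hEq
    simp only at hEq
    rw [← Set.sdiff_union_of_subset hT₁, ← Set.sdiff_union_of_subset hT₂, hEq]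
  have hle := Set.ncard_le_ncard_of_injOn _ hmaps hinj (hZfin.finite_subsets.subset (fun X hX => hX.1))
  omega

/-- **At most `6` triangles meet a triangle `T` on a spread core**: `#𝒯 ≤ 7 + #{triangles disjoint from T}` (at most two
other triangles through each of the three points of `T`, `S2.not_four_triangles_through`). -/
theorem ncard_triangles_le_seven_add_disjoint (M : Matroid α) [M.Finite]
    (hC1 : ∀ L ⊆ M.E, M.eRk L = 2 → L.ncard ≤ 3)
    (h9 : ∀ X ⊆ M.E, X.ncard ≤ 9 → X.encard ≤ M.eRk X + 3)
    {T : Set α} (hT : M.IsCircuit T) (hT3 : T.ncard = 3) :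
    {C : Set α | M.IsCircuit C ∧ C.ncard = 3}.ncard ≤
      7 + {C : Set α | M.IsCircuit C ∧ C.ncard = 3 ∧ Disjoint C T}.ncard := by
  classical
  set 𝒯 := {C : Set α | M.IsCircuit C ∧ C.ncard = 3} with h𝒯
  have h𝒯fin : 𝒯.Finite := M.ground_finite.finite_subsets.subset (fun C hC => hC.1.subset_ground)
  set 𝒟 := {C : Set α | M.IsCircuit C ∧ C.ncard = 3 ∧ Disjoint C T} with h𝒟
  have h𝒟fin : 𝒟.Finite := h𝒯fin.subset (fun C hC => ⟨hC.1, hC.2.1⟩)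
  -- the triangles through a point `x ∈ T` other than `T`: at most `2`
  have hthrough : ∀ x ∈ T, ({T' ∈ 𝒯 | T' ≠ T ∧ x ∈ T'} : Set (Set α)).ncard ≤ 2 := by
    intro x hxT
    by_contra hlt
    push Not at hlt
    obtain ⟨T₂, T₃, T₄, h2, h3, h4, h23, h24, h34⟩ :=
      (Set.two_lt_ncard_iff (h𝒯fin.subset (fun C hC => hC.1))).1 hlt
    exact not_four_triangles_through M hC1 h9 hT hT3 hxT h2.1.1 h2.1.2 h2.2.2 h3.1.1 h3.1.2 h3.2.2
      h4.1.1 h4.1.2 h4.2.2 (Ne.symm h2.2.1) (Ne.symm h3.2.1) (Ne.symm h4.2.1) h23 h24 h34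
  have hTfin : T.Finite := M.ground_finite.subset hT.subset_ground
  have hsum : (⋃ x ∈ T, ({T' ∈ 𝒯 | T' ≠ T ∧ x ∈ T'} : Set (Set α))).ncard ≤ 6 := by
    have hT' : (⋃ x ∈ T, ({T' ∈ 𝒯 | T' ≠ T ∧ x ∈ T'} : Set (Set α))) =
        ⋃ x ∈ hTfin.toFinset, ({T' ∈ 𝒯 | T' ≠ T ∧ x ∈ T'} : Set (Set α)) := by
      simp only [Set.Finite.mem_toFinset]
    rw [hT']
    refine (Finset.set_ncard_biUnion_le hTfin.toFinset _).trans ?_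
    calc ∑ x ∈ hTfin.toFinset, ({T' ∈ 𝒯 | T' ≠ T ∧ x ∈ T'} : Set (Set α)).ncard
        ≤ ∑ _x ∈ hTfin.toFinset, 2 :=
          Finset.sum_le_sum (fun x hx => hthrough x ((Set.Finite.mem_toFinset hTfin).1 hx))
      _ = 6 := by
        rw [Finset.sum_const, smul_eq_mul, ← Set.ncard_eq_toFinset_card T hTfin, hT3]
  -- every triangle is `T`, meets `T`, or avoids `T`
  have hcover : 𝒯 ⊆ ({T} ∪ ⋃ x ∈ T, ({T' ∈ 𝒯 | T' ≠ T ∧ x ∈ T'} : Set (Set α))) ∪ 𝒟 := by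
    intro T' hT'
    by_cases hne : T' = T
    · exact Or.inl (Or.inl (Set.mem_singleton_iff.2 hne))
    by_cases hdis : Disjoint T' T
    · exact Or.inr ⟨hT'.1, hT'.2, hdis⟩
    · rw [Set.not_disjoint_iff] at hdis
      obtain ⟨x, hxT', hxT⟩ := hdis
      exact Or.inl (Or.inr (Set.mem_iUnion₂.2 ⟨x, hxT, hT', hne, hxT'⟩))
  have hUfin : (⋃ x ∈ T, ({T' ∈ 𝒯 | T' ≠ T ∧ x ∈ T'} : Set (Set α))).Finite :=
    h𝒯fin.subset (fun C hC => by
      obtain ⟨x, -, hC⟩ := Set.mem_iUnion₂.1 hC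
      exact hC.1)
  have hle := Set.ncard_le_ncard hcover (((Set.finite_singleton T).union hUfin).union h𝒟fin)
  have hu1 := Set.ncard_union_le ({T} ∪ ⋃ x ∈ T, ({T' ∈ 𝒯 | T' ≠ T ∧ x ∈ T'} : Set (Set α))) 𝒟
  have hu2 := Set.ncard_union_le ({T} : Set (Set α)) (⋃ x ∈ T, ({T' ∈ 𝒯 | T' ≠ T ∧ x ∈ T'} : Set (Set α)))
  rw [Set.ncard_singleton] at hu2
  omega

/-- **With `≥ 9` triangles every triangle has two distinct disjoint ones** on a spread core. -/
theorem exists_two_disjoint_triangles_of_nine (M : Matroid α) [M.Finite]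
    (hC1 : ∀ L ⊆ M.E, M.eRk L = 2 → L.ncard ≤ 3)
    (h9 : ∀ X ⊆ M.E, X.ncard ≤ 9 → X.encard ≤ M.eRk X + 3)
    (h9t : 9 ≤ {C : Set α | M.IsCircuit C ∧ C.ncard = 3}.ncard)
    {T : Set α} (hT : M.IsCircuit T) (hT3 : T.ncard = 3) :
    ∃ T' T'' : Set α, M.IsCircuit T' ∧ T'.ncard = 3 ∧ Disjoint T' T ∧
      M.IsCircuit T'' ∧ T''.ncard = 3 ∧ Disjoint T'' T ∧ T' ≠ T'' := by
  have h := ncard_triangles_le_seven_add_disjoint M hC1 h9 hT hT3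
  have h𝒟fin : {C : Set α | M.IsCircuit C ∧ C.ncard = 3 ∧ Disjoint C T}.Finite :=
    M.ground_finite.finite_subsets.subset (fun C hC => hC.1.subset_ground)
  obtain ⟨T', T'', hT', hT'', hne⟩ := (Set.one_lt_ncard_iff h𝒟fin).1 (by omega)
  exact ⟨T', T'', hT'.1, hT'.2.1, hT'.2.2, hT''.1, hT''.2.1, hT''.2.2, hne⟩

end S2

end PercRepro
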